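import Summits.CriticalPhenomena.PercolationContinuityZ3.Theorems.PercNearOneGluingNoHeavyLowerTailSahiCombMixMixedFourSingleFF
import Summits.CriticalPhenomena.PercolationContinuityZ3.Theorems.PercNearOneGluingNoHeavyLowerTailSahiCombMixMixedFourSingleFT
import Summits.CriticalPhenomena.PercolationContinuityZ3.Theorems.PercNearOneGluingNoHeavyLowerTailSahiCombMixMixedFourSingleTF
import Summits.CriticalPhenomena.PercolationContinuityZ3.Theorems.PercNearOneGluingNoHeavyLowerTailSahiCombMixMixedFourSingleTT

/-!
# The comb (tensor-Bernstein) hierarchy for Sahi's `E_k`, LIV: `CombFourSingletonMixedCells` HOLDS — the singleton four-slot interface for mixed steps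

Support file of the one-cut programme (crux `NoHeavyLowerTail`, stmt-CriticalPhenomena-4575; cell `prim-masterthm`, seat P3, gen 9;
`run/shared/lean/prim/prim-masterthm/prim-masterthm-p3/HIERARCHY.md` §17(i)).  Assembles the four selector slices `combFourSingletonMixed_FF/FT/TF/TT`.  With this, the mixed
four-event step `SahiCombMix.combHereditary_orAndCoord_four_of_cells` (and `combHereditary_decisionList_four_of_cells`: all quadruples of common-order monotone decision
lists) depends only on the three-slot interface `CombCanonThreeSlotMixedCells` (43 composite cells, q = 1 certificates in hand, kit j121646).
HONEST FRAMING: nothing here asserts (M⁺-k) or `C_k` for `k ≥ 3`. [this work]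
-/

noncomputable section

open scoped Classical

namespace Summit.CriticalPhenomena.PercolationContinuityZ3.Theorems

open Finset Function
open Literature.Combinatorics.Sahi2008
open Literature.Probability.Percolation.DecisionTree (ind)
open SahiComb
open SahiCombDisjunct (orCoord)
open SahiCombHereditary (CombHereditary)


namespace SahiCombMix

/-- **`CombFourSingletonMixedCells` holds.** [this work] -/
theorem combFourSingletonMixedCells : CombFourSingletonMixedCells := by
  intro ι _ U e hUup hUe hU G₁ G₂
  cases h10 : G₁ 0 <;> cases h20 : G₂ 0
  · exact combFourSingletonMixed_FF U e hUup hUe hU G₁ G₂ h10 h20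
  · exact combFourSingletonMixed_FT U e hUup hUe hU G₁ G₂ h10 h20
  · exact combFourSingletonMixed_TF U e hUup hUe hU G₁ G₂ h10 h20
  · exact combFourSingletonMixed_TT U e hUup hUe hU G₁ G₂ h10 h20

/-- Hence decision-list quadruples (and the mixed four-event step) depend on the three-slot interface only. [this work] -/
theorem combHereditary_decisionList_four_of_threeSlotCells (hc : ∀ k, CombCanonThreeSlotMixedCells k) {ι : Type} [Fintype ι] (c : Fin 4 → Bool)
    (L : List (ι × (Fin 4 → Bool) × (Fin 4 → Bool))) (hL : (L.map Prod.fst).Nodup) :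
    CombHereditary (grow₂ (fun j => bif c j then (Set.univ : Set (Set ι)) else ∅) L) :=
  combHereditary_decisionList_four_of_cells hc combFourSingletonMixedCells c L hL

end SahiCombMix

end Summit.CriticalPhenomena.PercolationContinuityZ3.Theorems

end
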